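import Summits.AtomisticToContinuum.BoseEinsteinCondensation.Theses.BECDipoleTransport
import Summits.AtomisticToContinuum.BoseEinsteinCondensation.Theorems.BECDipoleTransportTransportToWindowSmearing
import Literature.MathematicalPhysics.QuantumManyBody.PeriodicBoseGasFracEnergy

/-!
# Route `BECDipoleTransport` — support item `SmearedVarianceIdentity` (stmt-AtomisticToContinuum-14626)

Closes the support item stmt-AtomisticToContinuum-14626 (exact signature of
`Summit.AtomisticToContinuum.BoseEinsteinCondensation.Theses.BECDipoleTransport.SmearedVarianceIdentity`):
for all `n`, `L > 0`, `R > 0` and every periodic `C¹` trial state `Ψ` of `n+1` bosons on the torus of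
side `L`,

  `2L³ · Σ_{k ≠ 0} e^{-R² p_k²/2} n_Ψ(k) = (n+1) · ∫_Ω∫_Ω∫_{Ω^n} |Ψ̄_R(x',Y) - Ψ̄_R(x,Y)|² dY dx' dx`,

`Ω = [0,L)³`, `p_k = 2πk/L`, `n_Ψ(k) = cellOccupation (n+1) L (L^{-3/2} e_k) Ψ` the occupation of the
normalised plane wave, `Ψ̄_R(x,Y) = ∫_{ℝ³} η_R(x - z) Ψ(z,Y) dz` the slice smeared by the unit-mass
Gaussian `η_R(w) = (πR²)⁻¹(√(πR²))⁻¹ e^{-|w|²/R²}` — the identity behind the transport reading of the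
route (it certifies the typed normalisations).

Contents (no new definitions):

* **the two-point variance on the cell through Fourier coefficients** — for continuous
  `f : ℝ³ → ℂ`: `ĉ_k(f - g) = ĉ_k f - ĉ_k g`, `ĉ_k(c) = c δ_{k,0}` (`cellFourierCoeff_sub'`,
  `cellFourierCoeff_const'`), `∫_Ω |f - c|² = L³ (|ĉ_0 f - c|² + Σ_{k ≠ 0} |ĉ_k f|²)`
  (`lintegral_cell_nnnorm_sub_const_sq`, Parseval `tsum_sq_cellFourierCoeff`), and the EXACT variance
  identity `∫_Ω∫_Ω |f(x') - f(x)|² dx' dx = 2 L⁶ Σ_{k ≠ 0} |ĉ_k f|²`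
  (`lintegral_cell_lintegral_cell_nnnorm_sub_sq`; the sibling file
  `BECDipoleTransportTransportToWindowSmearing.lean` has the inequality half `sq_tsum_le_lintegral_sub`);
* `smearedVariance_kernel` — the identity for a general continuous integrable kernel `η`:
  `(n+1) ∭ |Ψ̄(x',Y) - Ψ̄(x,Y)|² = 2L³ Σ_{k ≠ 0} |η̂_k|² ⟨φ_k, γ_Ψ φ_k⟩`, `η̂_k = ∫ η conj e_k`: per slice
  `Y` the smeared slice is continuous (`continuous_smear` of the sibling), the variance identity
  applies, the convolution rule `ĉ_k(Ψ̄(·,Y)) = η̂_k ĉ_k(Ψ(·,Y))` (`cellFourierCoeff_smear`, sibling) and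
  `L³|ĉ_k(Ψ(·,Y))|² = |∫_Ω conj(φ_k) Ψ(·,Y)|²` (`nnnorm_sq_integral_conj_planeWaveMode_mul`) turn the
  sum into slice inner products, `cellOccupation_succ` identifies `(n+1)∫_{Ω^n}` of these with
  `n_Ψ(k)`, and Tonelli moves `Y` outermost (joint measurability of `(x,Y) ↦ Ψ̄(x,Y)` by
  `StronglyMeasurable.integral_prod_right`);
* `smearedVarianceIdentity_proof` — the Gaussian case, `|η̂_R(p_k)|² = e^{-R²p_k²/2}`
  (`nnnorm_sq_gaussCoeff`, from the sibling's `integral_gaussian_mul_conj_cellWave`).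

Sources: [LSSY2005, §1.2 (1.17)] (occupations), [Fournais2020, (3.19)–(3.21)] (Fourier basis of the
torus), [PenroseOnsager1956]; Mathlib `Analysis.Fourier.AddCircleMulti`,
`Analysis.SpecialFunctions.Gaussian.FourierTransform`.
-/

noncomputable section

namespace Summit.AtomisticToContinuum.BoseEinsteinCondensation.Theorems.BECDipoleTransport

open MeasureTheory Complex
open scoped ENNReal NNReal ComplexConjugate
open Literature.MathematicalPhysics.QuantumManyBody.BoseGas

/-! ### The two-point variance on the cell through Fourier coefficients -/

section CellVariance

variable {L : ℝ}

/-- `conj e_k · f` is continuous for continuous `f`. [folklore] -/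
theorem continuous_conj_cellWave_mul {f : Space → ℂ} (hf : Continuous f) (k : Fin 3 → ℤ) :
    Continuous fun x => conj (cellWave L k x) * f x :=
  (Complex.continuous_conj.comp (contDiff_cellWave L k).continuous).mul hf

/-- Linearity of the cell Fourier coefficients: `ĉ_k(f - g) = ĉ_k f - ĉ_k g` (continuous `f, g`).
[folklore] -/
theorem cellFourierCoeff_sub' (hL : 0 < L) {f g : Space → ℂ} (hf : Continuous f) (hg : Continuous g)
    (k : Fin 3 → ℤ) :
    cellFourierCoeff L (fun x => f x - g x) k = cellFourierCoeff L f k - cellFourierCoeff L g k := by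
  rw [cellFourierCoeff_eq_integral hL, cellFourierCoeff_eq_integral hL, cellFourierCoeff_eq_integral hL,
    ← smul_sub, ← integral_sub (integrableOn_cell (continuous_conj_cellWave_mul hf k))
      (integrableOn_cell (continuous_conj_cellWave_mul hg k))]
  congr 1
  refine integral_congr_ae (Filter.Eventually.of_forall fun x => ?_)
  simp only [mul_sub]

/-- The Fourier coefficients of the zero function vanish. [folklore] -/
theorem cellFourierCoeff_zero_fun (hL : 0 < L) (k : Fin 3 → ℤ) :
    cellFourierCoeff L (fun _ => (0 : ℂ)) k = 0 := by
  rw [cellFourierCoeff_eq_integral hL]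
  simp

/-- `volume.real [0,L)³ = L³`. [folklore] -/
theorem volume_real_cell' (hL : 0 ≤ L) : volume.real (cell L) = L ^ 3 := by
  rw [measureReal_def, volume_cell, ← ENNReal.ofReal_pow hL, ENNReal.toReal_ofReal (by positivity)]

/-- The Fourier coefficients of a constant: `ĉ_k(c) = c` for `k = 0` and `0` otherwise (for `k ≠ 0`
pick `j` with `k_j ≠ 0` and use the derivative rule `ĉ_k(∂ⱼ c) = (2πi k_j/L) ĉ_k(c)` with `∂ⱼ c = 0`).
[folklore] -/
theorem cellFourierCoeff_const' (hL : 0 < L) (c : ℂ) (k : Fin 3 → ℤ) :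
    cellFourierCoeff L (fun _ => c) k = if k = 0 then c else 0 := by
  split_ifs with hk
  · subst hk
    rw [cellFourierCoeff_zero hL, setIntegral_const, volume_real_cell' hL.le, smul_smul,
      inv_mul_cancel₀ (pow_ne_zero _ hL.ne'), one_smul]
  · obtain ⟨j, hj⟩ := Function.ne_iff.1 hk
    have h := cellFourierCoeff_fderiv hL (φ := fun _ : Space => c) contDiff_const
      (fun _ _ => rfl) j k
    simp only [fderiv_fun_const, Pi.zero_apply, zero_apply, cellFourierCoeff_zero_fun hL] at h
    have hne : (2 * Real.pi * Complex.I * (k j) / L : ℂ) ≠ 0 := by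
      have h2 : (2 * Real.pi : ℂ) ≠ 0 := by exact_mod_cast (by positivity : (2 * Real.pi : ℝ) ≠ 0)
      have hkj : ((k j : ℤ) : ℂ) ≠ 0 := by exact_mod_cast hj
      have hLc : (L : ℂ) ≠ 0 := by exact_mod_cast hL.ne'
      exact div_ne_zero (mul_ne_zero (mul_ne_zero h2 Complex.I_ne_zero) hkj) hLc
    exact (mul_eq_zero.1 h.symm).resolve_left hne

/-- **One-point variance through Fourier coefficients**: for continuous `f` and a constant `c`,
`∫_Ω |f - c|² = L³ (|ĉ_0 f - c|² + Σ_{k ≠ 0} |ĉ_k f|²)` (Parseval on the cell applied to `f - c`,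
whose coefficients are `ĉ_k f - c δ_{k,0}`). [folklore] -/
theorem lintegral_cell_nnnorm_sub_const_sq (hL : 0 < L) {f : Space → ℂ} (hf : Continuous f) (c : ℂ) :
    ∫⁻ x in cell L, (‖f x - c‖₊ : ℝ≥0∞) ^ 2 =
      ENNReal.ofReal L ^ 3 * ((‖cellFourierCoeff L f 0 - c‖₊ : ℝ≥0∞) ^ 2 +
        ∑' k : Fin 3 → ℤ, if k ≠ 0 then (‖cellFourierCoeff L f k‖₊ : ℝ≥0∞) ^ 2 else 0) := by
  have hL3 : ENNReal.ofReal L ^ 3 ≠ 0 := pow_ne_zero _ (by simpa using hL)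
  have hL3' : ENNReal.ofReal L ^ 3 ≠ ⊤ := ENNReal.pow_ne_top ENNReal.ofReal_ne_top
  have hh : Continuous fun x => f x - c := hf.sub continuous_const
  have hP := tsum_sq_cellFourierCoeff hL hh
  have hcoef : ∀ k, cellFourierCoeff L (fun x => f x - c) k =
      cellFourierCoeff L f k - if k = 0 then c else 0 := fun k => by
    rw [cellFourierCoeff_sub' hL hf continuous_const, cellFourierCoeff_const' hL]
  calc ∫⁻ x in cell L, (‖f x - c‖₊ : ℝ≥0∞) ^ 2
      = ENNReal.ofReal L ^ 3 * ∑' k, (‖cellFourierCoeff L (fun x => f x - c) k‖₊ : ℝ≥0∞) ^ 2 := by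
        rw [hP, ← mul_assoc, ENNReal.mul_inv_cancel hL3 hL3', one_mul]
    _ = _ := by
        congr 1
        rw [ENNReal.tsum_eq_add_tsum_ite 0]
        congr 1
        · rw [hcoef, if_pos rfl]
        · refine tsum_congr fun k => ?_
          by_cases hk : k = 0
          · rw [if_pos hk, if_neg (not_not.2 hk)]
          · rw [if_neg hk, if_pos hk, hcoef, if_neg hk, sub_zero]

/-- **Two-point variance through Fourier coefficients**: for continuous `f`,
`∫_Ω∫_Ω |f(x') - f(x)|² dx' dx = 2 L³ · L³ Σ_{k ≠ 0} |ĉ_k f|²` (the one-point identity at `c = f(x)`,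
integrated in `x`, and once more at `c = ĉ_0 f`). [folklore] -/
theorem lintegral_cell_lintegral_cell_nnnorm_sub_sq (hL : 0 < L) {f : Space → ℂ} (hf : Continuous f) :
    ∫⁻ x in cell L, ∫⁻ x' in cell L, (‖f x' - f x‖₊ : ℝ≥0∞) ^ 2 =
      2 * (ENNReal.ofReal L ^ 3 * (ENNReal.ofReal L ^ 3 *
        ∑' k : Fin 3 → ℤ, if k ≠ 0 then (‖cellFourierCoeff L f k‖₊ : ℝ≥0∞) ^ 2 else 0)) := by
  have hL3' : ENNReal.ofReal L ^ 3 ≠ ⊤ := ENNReal.pow_ne_top ENNReal.ofReal_ne_top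
  set S : ℝ≥0∞ := ∑' k : Fin 3 → ℤ, if k ≠ 0 then (‖cellFourierCoeff L f k‖₊ : ℝ≥0∞) ^ 2 else 0
    with hS
  have h1 : ∀ x, ∫⁻ x' in cell L, (‖f x' - f x‖₊ : ℝ≥0∞) ^ 2 =
      ENNReal.ofReal L ^ 3 * ((‖cellFourierCoeff L f 0 - f x‖₊ : ℝ≥0∞) ^ 2 + S) := fun x =>
    lintegral_cell_nnnorm_sub_const_sq hL hf (f x)
  have hmeas : Measurable fun x => (‖cellFourierCoeff L f 0 - f x‖₊ : ℝ≥0∞) ^ 2 :=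
    ((measurable_const.sub hf.measurable).nnnorm.coe_nnreal_ennreal).pow_const _
  have h2 : ∫⁻ x in cell L, (‖cellFourierCoeff L f 0 - f x‖₊ : ℝ≥0∞) ^ 2 = ENNReal.ofReal L ^ 3 * S := by
    have hrev : ∀ x, (‖cellFourierCoeff L f 0 - f x‖₊ : ℝ≥0∞) ^ 2 =
        (‖f x - cellFourierCoeff L f 0‖₊ : ℝ≥0∞) ^ 2 := fun x => by rw [← neg_sub, nnnorm_neg]
    simp only [hrev]
    rw [lintegral_cell_nnnorm_sub_const_sq hL hf, sub_self, nnnorm_zero, ENNReal.coe_zero,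
      zero_pow two_ne_zero, zero_add]
  simp only [h1]
  rw [lintegral_const_mul' _ _ hL3', lintegral_add_left hmeas, h2, lintegral_const,
    Measure.restrict_apply MeasurableSet.univ, Set.univ_inter, volume_cell]
  ring

end CellVariance

/-! ### The identity for a general smoothing kernel, and the Gaussian case -/

section Main

variable {n : ℕ} {L : ℝ}

/-- `|η̂_R(p_k)|² = e^{-R² p_k²/2}` with `p_k = 2πk/L`: the squared modulus of the Gaussian's Fourier
coefficient (`integral_gaussian_mul_conj_cellWave`: `η̂_R = e^{-R²p_k²/4}`) is the weight of the
Gaussian window. [folklore] -/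
theorem nnnorm_sq_gaussCoeff (hL : 0 < L) {R : ℝ} (hR : 0 < R) (k : Fin 3 → ℤ) :
    ((‖∫ w : Space, ((((Real.pi * R ^ 2)⁻¹ * (Real.sqrt (Real.pi * R ^ 2))⁻¹ *
        Real.exp (-(‖w‖ ^ 2 / R ^ 2)) : ℝ) : ℂ) * conj (cellWave L k w))‖₊ : ℝ≥0∞) ^ 2) =
      ENNReal.ofReal (Real.exp (-(R ^ 2 * (2 * Real.pi / L) ^ 2 * (∑ l, (k l : ℝ) ^ 2) / 2))) := by
  rw [integral_gaussian_mul_conj_cellWave hL.ne' hR k, coe_nnnorm_sq_eq_ofReal, Complex.norm_real,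
    Real.norm_of_nonneg (Real.exp_pos _).le, sq, ← Real.exp_add]
  congr 2
  ring

/-- **The smeared two-point variance through plane-wave occupations, for a general kernel.** For a
continuous integrable real kernel `η` on `ℝ³` and a periodic trial state `Ψ` of `n+1` bosons on the
torus of side `L`, with `Ψ̄(x,Y) = ∫ η(x - z) Ψ(z,Y) dz`:
`(n+1) ∫_Ω∫_Ω∫_{Ω^n} |Ψ̄(x',Y) - Ψ̄(x,Y)|² = 2L³ Σ_{k ≠ 0} |η̂_k|² ⟨φ_k, γ_Ψ φ_k⟩`,
`η̂_k = ∫ η conj e_k`, `φ_k = planeWaveMode L k` (variance identity on the cell for each smoothed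
slice, the convolution rule, `cellOccupation_succ`, Tonelli). [folklore] -/
theorem smearedVariance_kernel (hL : 0 < L) {η : Space → ℝ} (hηc : Continuous η)
    (hηi : Integrable η) (Ψ : PeriodicTrialState (n + 1) L) :
    ((n : ℝ≥0∞) + 1) * (∫⁻ x in cell L, ∫⁻ x' in cell L, ∫⁻ Y in cellN n L,
        (‖(∫ z : Space, (η (x' - z) : ℂ) * Ψ.ψ (Matrix.vecCons z Y)) -
            (∫ z : Space, (η (x - z) : ℂ) * Ψ.ψ (Matrix.vecCons z Y))‖₊ : ℝ≥0∞) ^ 2) =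
      2 * ENNReal.ofReal (L ^ 3) * ∑' k : Fin 3 → ℤ, (if k ≠ 0 then
        ((‖∫ w : Space, (η w : ℂ) * conj (cellWave L k w)‖₊ : ℝ≥0∞) ^ 2) *
          cellOccupation (n + 1) L (planeWaveMode L k) Ψ.ψ else 0) := by
  have hΨc : Continuous Ψ.ψ := Ψ.contDiff.continuous
  have hslc : ∀ Y : Config n, Continuous fun z => Ψ.ψ (Matrix.vecCons z Y) := fun Y =>
    hΨc.comp (continuous_id.matrixVecCons continuous_const)
  have hslp : ∀ (Y : Config n) (z : Space) (j : Fin 3),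
      Ψ.ψ (Matrix.vecCons (z + EuclideanSpace.single j L) Y) = Ψ.ψ (Matrix.vecCons z Y) :=
    fun Y z j => Ψ.vecCons_add_axis_left z Y j
  obtain ⟨M, hM⟩ := exists_bound_of_periodic hL hΨc Ψ.periodic
  -- notation: smoothed slices `F`, slice inner products `T`, weights `a`
  set F : Config n → Space → ℂ := fun Y x => ∫ w, (η w : ℂ) * Ψ.ψ (Matrix.vecCons (x - w) Y)
    with hF
  set T : (Fin 3 → ℤ) → Config n → ℝ≥0∞ := fun k Y =>
    (‖∫ x in cell L, conj (planeWaveMode L k x) * Ψ.ψ (Matrix.vecCons x Y)‖₊ : ℝ≥0∞) ^ 2 with hT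
  set a : (Fin 3 → ℤ) → ℝ≥0∞ := fun k => if k ≠ 0 then
    ((‖∫ w : Space, (η w : ℂ) * conj (cellWave L k w)‖₊ : ℝ≥0∞) ^ 2) else 0 with ha
  -- (1) substitution and continuity of the smoothed slices
  have hsub : ∀ (x : Space) (Y : Config n),
      (∫ z : Space, (η (x - z) : ℂ) * Ψ.ψ (Matrix.vecCons z Y)) = F Y x := fun x Y =>
    integral_kernel_sub_mul η (fun z => Ψ.ψ (Matrix.vecCons z Y)) x
  have hFc : ∀ Y, Continuous (F Y) := fun Y =>
    (continuous_smear hΨc hM hηc hηi).comp (continuous_id.prodMk continuous_const)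
  -- (2) the Fourier coefficients of the smoothed slices (convolution rule)
  have hcoef : ∀ (Y : Config n) (k : Fin 3 → ℤ), ENNReal.ofReal L ^ 3 *
      (if k ≠ 0 then ((‖cellFourierCoeff L (F Y) k‖₊ : ℝ≥0∞) ^ 2) else 0) = a k * T k Y := by
    intro Y k
    simp only [ha, hT]
    rw [nnnorm_sq_integral_conj_planeWaveMode_mul hL k]
    by_cases hk : k = 0
    · simp [hk]
    · rw [if_pos hk, if_pos hk, hF,
        cellFourierCoeff_smear hL (hslc Y) (hslp Y) (fun z => hM _) hηc hηi k, nnnorm_mul,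
        ENNReal.coe_mul, mul_pow]
      ring
  -- (3) the variance identity for each smoothed slice
  have hvar : ∀ Y : Config n, ∫⁻ x in cell L, ∫⁻ x' in cell L, (‖F Y x' - F Y x‖₊ : ℝ≥0∞) ^ 2 =
      2 * (ENNReal.ofReal L ^ 3 * ∑' k, a k * T k Y) := by
    intro Y
    rw [lintegral_cell_lintegral_cell_nnnorm_sub_sq hL (hFc Y)]
    congr 2
    rw [← ENNReal.tsum_mul_left]
    exact tsum_congr fun k => hcoef Y k
  -- (4) measurability
  have hTm : ∀ k, Measurable (T k) := fun k => measurable_sliceInner (continuous_planeWaveMode L k) hΨc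
  have hfm : Measurable fun p : Space × Config n =>
      ∫ z : Space, (η (p.1 - z) : ℂ) * Ψ.ψ (Matrix.vecCons z p.2) := by
    have h : StronglyMeasurable (Function.uncurry fun (p : Space × Config n) (z : Space) =>
        (η (p.1 - z) : ℂ) * Ψ.ψ (Matrix.vecCons z p.2)) := by
      refine Continuous.stronglyMeasurable ?_
      exact (Complex.continuous_ofReal.comp (hηc.comp ((continuous_fst.comp continuous_fst).sub
        continuous_snd))).mul (hΨc.comp (continuous_snd.matrixVecCons (continuous_snd.comp continuous_fst)))
    exact (h.integral_prod_right (ν := volume)).measurable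
  set G : Space → Space → Config n → ℝ≥0∞ := fun x x' Y =>
    (‖(∫ z : Space, (η (x' - z) : ℂ) * Ψ.ψ (Matrix.vecCons z Y)) -
        (∫ z : Space, (η (x - z) : ℂ) * Ψ.ψ (Matrix.vecCons z Y))‖₊ : ℝ≥0∞) ^ 2 with hG
  have hG1 : ∀ x : Space, Measurable (Function.uncurry (G x)) := fun x =>
    ((hfm.sub (hfm.comp (measurable_const.prodMk measurable_snd))).nnnorm.coe_nnreal_ennreal).pow_const _
  have hG2 : Measurable fun q : (Space × Config n) × Space => G q.1.1 q.2 q.1.2 :=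
    (((hfm.comp (measurable_snd.prodMk (measurable_snd.comp measurable_fst))).sub
      (hfm.comp measurable_fst)).nnnorm.coe_nnreal_ennreal).pow_const _
  have hG3 : Measurable (Function.uncurry fun (x : Space) (Y : Config n) => ∫⁻ x' in cell L, G x x' Y) :=
    hG2.lintegral_prod_right'
  -- (5) Tonelli: `Y` outermost
  have hswap : (∫⁻ x in cell L, ∫⁻ x' in cell L, ∫⁻ Y in cellN n L, G x x' Y) =
      ∫⁻ Y in cellN n L, ∫⁻ x in cell L, ∫⁻ x' in cell L, G x x' Y := by
    calc (∫⁻ x in cell L, ∫⁻ x' in cell L, ∫⁻ Y in cellN n L, G x x' Y)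
        = ∫⁻ x in cell L, ∫⁻ Y in cellN n L, ∫⁻ x' in cell L, G x x' Y :=
          lintegral_congr fun x => lintegral_lintegral_swap (hG1 x).aemeasurable
      _ = ∫⁻ Y in cellN n L, ∫⁻ x in cell L, ∫⁻ x' in cell L, G x x' Y :=
          lintegral_lintegral_swap hG3.aemeasurable
  -- (6) assemble
  have hY : ∀ Y : Config n, (∫⁻ x in cell L, ∫⁻ x' in cell L, G x x' Y) =
      2 * (ENNReal.ofReal L ^ 3 * ∑' k, a k * T k Y) := by
    intro Y
    simp only [hG, hsub]
    exact hvar Y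
  have hocc : ∀ k, (if k ≠ 0 then ((‖∫ w : Space, (η w : ℂ) * conj (cellWave L k w)‖₊ : ℝ≥0∞) ^ 2) *
      cellOccupation (n + 1) L (planeWaveMode L k) Ψ.ψ else 0) =
      a k * (((n : ℝ≥0∞) + 1) * ∫⁻ Y in cellN n L, T k Y) := by
    intro k
    simp only [ha, hT, cellOccupation_succ]
    split_ifs <;> simp
  have hsumm : Measurable fun Y => ∑' k, a k * T k Y :=
    Measurable.tsum fun k => (hTm k).const_mul _
  rw [show (fun x => ∫⁻ x' in cell L, ∫⁻ Y in cellN n L, G x x' Y) =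
      fun x => ∫⁻ x' in cell L, ∫⁻ Y in cellN n L, G x x' Y from rfl]
  rw [hswap]
  simp only [hY, hocc]
  rw [lintegral_const_mul _ (hsumm.const_mul _), lintegral_const_mul _ hsumm,
    lintegral_tsum fun k => ((hTm k).const_mul _).aemeasurable]
  simp only [lintegral_const_mul _ (hTm _)]
  rw [ENNReal.ofReal_pow hL.le]
  have hpull : (∑' k, a k * (((n : ℝ≥0∞) + 1) * ∫⁻ Y in cellN n L, T k Y)) =
      ((n : ℝ≥0∞) + 1) * ∑' k, a k * ∫⁻ Y in cellN n L, T k Y := by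
    rw [← ENNReal.tsum_mul_left]
    exact tsum_congr fun k => by ring
  rw [hpull]
  ring

end Main

/-- **`SmearedVarianceIdentity`** (closes stmt-AtomisticToContinuum-14626, exact route signature): for
all `n`, `L > 0`, `R > 0` and every periodic `C¹` trial state `Ψ` of `n+1` bosons on the torus of side
`L`, `2L³ Σ_{k ≠ 0} e^{-R²p_k²/2} n_Ψ(k) = (n+1) ∫_Ω∫_Ω∫_{Ω^n} |Ψ̄_R(x',Y) - Ψ̄_R(x,Y)|²`, where
`n_Ψ(k)` is the occupation of the normalised plane wave `L^{-3/2} e_k`, `p_k = 2πk/L`, and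
`Ψ̄_R(x,Y) = ∫ η_R(x - z) Ψ(z,Y) dz` with the unit-mass Gaussian `η_R(w) = (πR²)^{-3/2} e^{-|w|²/R²}`
(`smearedVariance_kernel` with `|η̂_R(p_k)|² = e^{-R²p_k²/2}`). [cite: LSSY2005, §1.2 (1.17)] -/
theorem smearedVarianceIdentity_proof :
    Summit.AtomisticToContinuum.BoseEinsteinCondensation.Theses.BECDipoleTransport.SmearedVarianceIdentity := by
  intro n L R hL hR Ψ
  have hmode : ∀ k : Fin 3 → ℤ,
      planeWaveMode L k = fun x => ((Real.sqrt (L ^ 3))⁻¹ : ℂ) * cellWave L k x := fun k =>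
    funext (planeWaveMode_eq L k)
  have key := smearedVariance_kernel hL
    (continuous_gaussianKernel ((Real.pi * R ^ 2)⁻¹ * (Real.sqrt (Real.pi * R ^ 2))⁻¹) R)
    (integrable_gaussianKernel ((Real.pi * R ^ 2)⁻¹ * (Real.sqrt (Real.pi * R ^ 2))⁻¹) hR.ne') Ψ
  simp only [nnnorm_sq_gaussCoeff hL hR, hmode] at key
  exact key.symm

end Summit.AtomisticToContinuum.BoseEinsteinCondensation.Theorems.BECDipoleTransport

end
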